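import Mathlib
import Summits.Ventures.PercRepro2.K5HyperCoeffsI
import Summits.Ventures.PercRepro2.K5HyperB25
import Summits.Ventures.PercRepro2.K5HyperK3Cmp
import Summits.Ventures.PercRepro2.K5HyperK3TvT25

/-!
# THE CRUX KERNEL'S STAR STATEMENTS AS COEFFICIENT INEQUALITIES AT EVERY `K₅` PROFILE
(blind cell PercRepro2, typer-1 g10; mine-1 §23.12)

`cPosOn3 / cNegOn3` are the masked triple counts of the `10 + 10` products of `K₃` (`K5K3Kernel.lean` tables at
the marks `(0, 1, 2, 3, 4)`); the Kronecker numbers of `K5HyperK3.lean` / `K5HyperK3Cmp.lean` (base `2^23`) and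
`K5HyperK3TvT25.lean` (base `2^25`) encode their placement sums (`posOn3_eq`, `posOn35_eq`, the generic
`sumT1_eq` … of `K5HyperCoeffsI.lean` and their base-`2^25` twins `sumT1_eq5`, `sumE3_eq5`).  The coefficient
bounds: `M-TRI` `120 · 3^10 < 2^23`, `TvT-TRI` `300 · 3^10 < 2^25`, the base terms `30 · 3^10 < 2^23`.  Hence

* **`cNegM3_le_cPosM3`**: `M-TRI ≥ 0` at every `K₅` profile from its certificate;
* **`cNegTvT3_le_cPosTvT3`**: `TvT-TRI ≥ 0` (base `2^25`);
* **`cT13_le`**, **`cT23_le`**: `N(K₅ + T(1)) ≥ 0`, `N(K₅ + T(2)) ≥ 0`.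
-/

namespace Summit.Ventures.PercRepro2

namespace K5

/-! ## The base-`2^25` encodings of the placement sums -/

section Sums5

variable (g : (Fin 10 → Bool) → (Fin 10 → Bool) → (Fin 10 → Bool) → (Fin 10 → Fin 4) → ℕ)
  (f : (Fin 10 → Bool) → (Fin 10 → Bool) → (Fin 10 → Bool) → ℕ)
  (hfg : ∀ S₁ S₂ S₃, f S₁ S₂ S₃ = ∑ k, g S₁ S₂ S₃ k * KB5 ^ idx4 k)

include hfg in
/-- The base-`2^25` encoding of `sumT1`. -/
lemma sumT1_eq5 (D : Fin 10 → Bool) : sumT1 f D = ∑ k, csumT1 g D k * KB5 ^ idx4 k := by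
  unfold sumT1 csumT1
  simp only [hfg, sum_add_mulB5]

include hfg in
/-- The base-`2^25` encoding of `sumE3`. -/
lemma sumE3_eq5 (P₁ P₂ P₃ : Fin 10 → Bool) :
    sumE3 f P₁ P₂ P₃ = ∑ k, csumE3 g P₁ P₂ P₃ k * KB5 ^ idx4 k := by
  unfold sumE3 sumE3a sumE3b sumE3c csumE3 csumE3a csumE3b csumE3c
  simp only [hfg, sum_add_mulB5]

end Sums5

/-! ## The `K₃` tables through the masks -/

section Coeffs3

/-- The positive products of `K₃` on a pattern (marks `(0, 1, 2, 3, 4)`). -/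
def cPosOn3 (S₁ S₂ S₃ : Fin 10 → Bool) (k : Fin 10 → Fin 4) : ℕ :=
  cOn tPD tQ (t4p 4) S₁ S₂ S₃ k + cOn tQ tPDoU (t5p 4) S₁ S₂ S₃ k + cOn tPD tQ (t6m 4) S₁ S₂ S₃ k +
    cOn tPD (t7p 4) (t7m 0) S₁ S₂ S₃ k + cOn tPD (t7m 4) (t7p 0) S₁ S₂ S₃ k +
    cOn tPDoU (t7p 4) (t7m 3) S₁ S₂ S₃ k + cOn tPDoU (t7m 4) (t7p 3) S₁ S₂ S₃ k +
    cOn tPD (t7p 4) t10p S₁ S₂ S₃ k + cOn tPD (t7m 4) t10m S₁ S₂ S₃ k + cOn tQ (t12 4) tPDoU S₁ S₂ S₃ k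

/-- The negative products of `K₃` on a pattern. -/
def cNegOn3 (S₁ S₂ S₃ : Fin 10 → Bool) (k : Fin 10 → Fin 4) : ℕ :=
  cOn tPD tQ (t4m 4) S₁ S₂ S₃ k + cOn tQ tPDoU (t5m 4) S₁ S₂ S₃ k + cOn tPD tQ (t6p 4) S₁ S₂ S₃ k +
    cOn tPD (t7p 4) (t7p 0) S₁ S₂ S₃ k + cOn tPD (t7m 4) (t7m 0) S₁ S₂ S₃ k +
    cOn tPDoU (t7p 4) (t7p 3) S₁ S₂ S₃ k + cOn tPDoU (t7m 4) (t7m 3) S₁ S₂ S₃ k +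
    cOn tPD (t7p 4) t10m S₁ S₂ S₃ k + cOn tPD (t7m 4) t10p S₁ S₂ S₃ k + cOn tPD tQ (t11 4) S₁ S₂ S₃ k

/-- `posOn3` encodes `cPosOn3` (base `2^23`). -/
lemma posOn3_eq (S₁ S₂ S₃ : Fin 10 → Bool) : posOn3 S₁ S₂ S₃ = ∑ k, cPosOn3 S₁ S₂ S₃ k * KB3 ^ idx4 k := by
  unfold posOn3
  simp only [kron3_mul_mul, sum_add_mulB]
  rfl

/-- `negOn3` encodes `cNegOn3` (base `2^23`). -/
lemma negOn3_eq (S₁ S₂ S₃ : Fin 10 → Bool) : negOn3 S₁ S₂ S₃ = ∑ k, cNegOn3 S₁ S₂ S₃ k * KB3 ^ idx4 k := by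
  unfold negOn3
  simp only [kron3_mul_mul, sum_add_mulB]
  rfl

/-- `posOn35` encodes `cPosOn3` (base `2^25`). -/
lemma posOn35_eq (S₁ S₂ S₃ : Fin 10 → Bool) : posOn35 S₁ S₂ S₃ = ∑ k, cPosOn3 S₁ S₂ S₃ k * KB5 ^ idx4 k := by
  unfold posOn35
  simp only [kron35_mul_mul, sum_add_mulB5]
  rfl

/-- `negOn35` encodes `cNegOn3` (base `2^25`). -/
lemma negOn35_eq (S₁ S₂ S₃ : Fin 10 → Bool) : negOn35 S₁ S₂ S₃ = ∑ k, cNegOn3 S₁ S₂ S₃ k * KB5 ^ idx4 k := by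
  unfold negOn35
  simp only [kron35_mul_mul, sum_add_mulB5]
  rfl

/-- Ten masked counts. -/
lemma cPosOn3_le (S₁ S₂ S₃ : Fin 10 → Bool) (k : Fin 10 → Fin 4) : cPosOn3 S₁ S₂ S₃ k ≤ 10 * 59049 := by
  unfold cPosOn3
  have := cOn_le tPD tQ (t4p 4) S₁ S₂ S₃ k; have := cOn_le tQ tPDoU (t5p 4) S₁ S₂ S₃ k
  have := cOn_le tPD tQ (t6m 4) S₁ S₂ S₃ k; have := cOn_le tPD (t7p 4) (t7m 0) S₁ S₂ S₃ k
  have := cOn_le tPD (t7m 4) (t7p 0) S₁ S₂ S₃ k; have := cOn_le tPDoU (t7p 4) (t7m 3) S₁ S₂ S₃ k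
  have := cOn_le tPDoU (t7m 4) (t7p 3) S₁ S₂ S₃ k; have := cOn_le tPD (t7p 4) t10p S₁ S₂ S₃ k
  have := cOn_le tPD (t7m 4) t10m S₁ S₂ S₃ k; have := cOn_le tQ (t12 4) tPDoU S₁ S₂ S₃ k
  omega

/-- Ten masked counts. -/
lemma cNegOn3_le (S₁ S₂ S₃ : Fin 10 → Bool) (k : Fin 10 → Fin 4) : cNegOn3 S₁ S₂ S₃ k ≤ 10 * 59049 := by
  unfold cNegOn3
  have := cOn_le tPD tQ (t4m 4) S₁ S₂ S₃ k; have := cOn_le tQ tPDoU (t5m 4) S₁ S₂ S₃ k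
  have := cOn_le tPD tQ (t6p 4) S₁ S₂ S₃ k; have := cOn_le tPD (t7p 4) (t7p 0) S₁ S₂ S₃ k
  have := cOn_le tPD (t7m 4) (t7m 0) S₁ S₂ S₃ k; have := cOn_le tPDoU (t7p 4) (t7p 3) S₁ S₂ S₃ k
  have := cOn_le tPDoU (t7m 4) (t7m 3) S₁ S₂ S₃ k; have := cOn_le tPD (t7p 4) t10m S₁ S₂ S₃ k
  have := cOn_le tPD (t7m 4) t10p S₁ S₂ S₃ k; have := cOn_le tPD tQ (t11 4) S₁ S₂ S₃ k
  omega

/-- The positive side of `M-TRI`: `N(H+T(1)+e(1))⁺ + N(H+T(1))⁻`. -/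
def cPosM3 (D P : Fin 10 → Bool) (k : Fin 10 → Fin 4) : ℕ := csumT1e1 cPosOn3 D P k + csumT1 cNegOn3 D k

/-- The negative side of `M-TRI`. -/
def cNegM3 (D P : Fin 10 → Bool) (k : Fin 10 → Fin 4) : ℕ := csumT1e1 cNegOn3 D P k + csumT1 cPosOn3 D k

/-- The positive side of `TvT-TRI`: `N(H+△(1,1,1))⁺ + N(H+T(1))⁻`. -/
def cPosTvT3 (a b c : ℕ) (k : Fin 10 → Fin 4) : ℕ :=
  csumE3 cPosOn3 (pairMask a b) (pairMask a c) (pairMask b c) k + csumT1 cNegOn3 (triMask a b c) k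

/-- The negative side of `TvT-TRI`. -/
def cNegTvT3 (a b c : ℕ) (k : Fin 10 → Fin 4) : ℕ :=
  csumE3 cNegOn3 (pairMask a b) (pairMask a c) (pairMask b c) k + csumT1 cPosOn3 (triMask a b c) k

/-- `kPosM3` encodes `cPosM3`. -/
lemma kPosM3_eq (D P : Fin 10 → Bool) : kPosM3 D P = ∑ k, cPosM3 D P k * KB3 ^ idx4 k := by
  unfold kPosM3
  rw [sumT1e1_eq cPosOn3 posOn3 posOn3_eq, sumT1_eq cNegOn3 negOn3 negOn3_eq, sum_add_mulB]
  rfl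

/-- `kNegM3` encodes `cNegM3`. -/
lemma kNegM3_eq (D P : Fin 10 → Bool) : kNegM3 D P = ∑ k, cNegM3 D P k * KB3 ^ idx4 k := by
  unfold kNegM3
  rw [sumT1e1_eq cNegOn3 negOn3 negOn3_eq, sumT1_eq cPosOn3 posOn3 posOn3_eq, sum_add_mulB]
  rfl

/-- `kPosTvT35` encodes `cPosTvT3` (base `2^25`). -/
lemma kPosTvT35_eq (a b c : ℕ) : kPosTvT35 a b c = ∑ k, cPosTvT3 a b c k * KB5 ^ idx4 k := by
  unfold kPosTvT35
  rw [sumE3_eq5 cPosOn3 posOn35 posOn35_eq, sumT1_eq5 cNegOn3 negOn35 negOn35_eq, sum_add_mulB5]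
  rfl

/-- `kNegTvT35` encodes `cNegTvT3` (base `2^25`). -/
lemma kNegTvT35_eq (a b c : ℕ) : kNegTvT35 a b c = ∑ k, cNegTvT3 a b c k * KB5 ^ idx4 k := by
  unfold kNegTvT35
  rw [sumE3_eq5 cNegOn3 negOn35 negOn35_eq, sumT1_eq5 cPosOn3 posOn35 posOn35_eq, sum_add_mulB5]
  rfl

/-- `KB5 = 33554432`. -/
lemma KB5_val : KB5 = 33554432 := by rw [KB5_eq]; norm_num

/-- The `M-TRI` coefficients are below `KB3` (`120 · 3^10 < 2^23`). -/
lemma cPosM3_lt (D P : Fin 10 → Bool) (k : Fin 10 → Fin 4) : cPosM3 D P k < KB3 := by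
  unfold cPosM3; rw [KB3_val]
  have := csumT1e1_le cPosOn3 (10 * 59049) cPosOn3_le D P k
  have := csumT1_le cNegOn3 (10 * 59049) cNegOn3_le D k
  omega

/-- The `M-TRI` coefficients are below `KB3`. -/
lemma cNegM3_lt (D P : Fin 10 → Bool) (k : Fin 10 → Fin 4) : cNegM3 D P k < KB3 := by
  unfold cNegM3; rw [KB3_val]
  have := csumT1e1_le cNegOn3 (10 * 59049) cNegOn3_le D P k
  have := csumT1_le cPosOn3 (10 * 59049) cPosOn3_le D k
  omega

/-- The `TvT-TRI` coefficients are below `KB5` (`300 · 3^10 < 2^25`). -/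
lemma cPosTvT3_lt (a b c : ℕ) (k : Fin 10 → Fin 4) : cPosTvT3 a b c k < KB5 := by
  unfold cPosTvT3; rw [KB5_val]
  have := csumE3_le cPosOn3 (10 * 59049) cPosOn3_le (pairMask a b) (pairMask a c) (pairMask b c) k
  have := csumT1_le cNegOn3 (10 * 59049) cNegOn3_le (triMask a b c) k
  omega

/-- The `TvT-TRI` coefficients are below `KB5`. -/
lemma cNegTvT3_lt (a b c : ℕ) (k : Fin 10 → Fin 4) : cNegTvT3 a b c k < KB5 := by
  unfold cNegTvT3; rw [KB5_val]
  have := csumE3_le cNegOn3 (10 * 59049) cNegOn3_le (pairMask a b) (pairMask a c) (pairMask b c) k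
  have := csumT1_le cPosOn3 (10 * 59049) cPosOn3_le (triMask a b c) k
  omega

/-- **`M-TRI ≥ 0` at every `K₅` profile**, from its certificate. -/
theorem cNegM3_le_cPosM3 (D P : Fin 10 → Bool) (hc : CertLE (kNegM3 D P) (kPosM3 D P)) (k : Fin 10 → Fin 4) :
    cNegM3 D P k ≤ cPosM3 D P k :=
  le_of_certLE (cPosM3 D P) (cNegM3 D P) (cPosM3_lt D P) (cNegM3_lt D P) (kPosM3_eq D P) (kNegM3_eq D P) hc k

/-- **`TvT-TRI ≥ 0` at every `K₅` profile**, from its base-`2^25` certificate. -/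
theorem cNegTvT3_le_cPosTvT3 (a b c : ℕ) (hc : CertLE5 (kNegTvT35 a b c) (kPosTvT35 a b c))
    (k : Fin 10 → Fin 4) : cNegTvT3 a b c k ≤ cPosTvT3 a b c k :=
  le_of_certLE5 (cPosTvT3 a b c) (cNegTvT3 a b c) (cPosTvT3_lt a b c) (cNegTvT3_lt a b c)
    (kPosTvT35_eq a b c) (kNegTvT35_eq a b c) hc k

/-- **`N(K₅ + D(1)) ≥ 0` at every `K₅` profile**, from its certificate. -/
theorem cT13_le (D : Fin 10 → Bool) (hc : CertLE (sumT1 negOn3 D) (sumT1 posOn3 D)) (k : Fin 10 → Fin 4) :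
    csumT1 cNegOn3 D k ≤ csumT1 cPosOn3 D k :=
  le_of_certLE (csumT1 cPosOn3 D) (csumT1 cNegOn3 D)
    (fun k => by rw [KB3_val]; have := csumT1_le cPosOn3 (10 * 59049) cPosOn3_le D k; omega)
    (fun k => by rw [KB3_val]; have := csumT1_le cNegOn3 (10 * 59049) cNegOn3_le D k; omega)
    (sumT1_eq cPosOn3 posOn3 posOn3_eq D) (sumT1_eq cNegOn3 negOn3 negOn3_eq D) hc k

/-- **`N(K₅ + D(2)) ≥ 0` at every `K₅` profile**, from its certificate. -/
theorem cT23_le (D : Fin 10 → Bool) (hc : CertLE (sumT2 negOn3 D) (sumT2 posOn3 D)) (k : Fin 10 → Fin 4) :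
    csumT2 cNegOn3 D k ≤ csumT2 cPosOn3 D k :=
  le_of_certLE (csumT2 cPosOn3 D) (csumT2 cNegOn3 D)
    (fun k => by rw [KB3_val]; have := csumT2_le cPosOn3 (10 * 59049) cPosOn3_le D k; omega)
    (fun k => by rw [KB3_val]; have := csumT2_le cNegOn3 (10 * 59049) cNegOn3_le D k; omega)
    (sumT2_eq cPosOn3 posOn3 posOn3_eq D) (sumT2_eq cNegOn3 negOn3 negOn3_eq D) hc k

end Coeffs3

end K5

end Summit.Ventures.PercRepro2
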